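import Mathlib
import Literature.Analysis.Complex.CaratheodoryCoefficient

/-!
# The holomorphic logarithm of a zero-free function on a disc and Carathéodory's bound on its Taylor coefficients

Topic `Literature/Analysis/Complex`; sequel of `CaratheodoryCoefficient.lean` (Carathéodory's coefficient inequality,
the coefficient form of the Borel–Carathéodory theorem).  Everything here is proved:

* `exists_log_of_ne_zero_on_ball` — an entire-type function `H` (`H′` given and differentiable) with `H ≠ 0` on the
  disc `‖s‖ < R` and `H(0) = 1` has a holomorphic logarithm `g` there (`g(0) = 0`, `g′ = H′/H`, `e^g = H`): the
  primitive of `H′/H` on the disc (Mathlib `DifferentiableOn.isExactOn_ball`) and constancy of `He^{−g}`;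
* `norm_iteratedDeriv_le_of_re_le` — **Carathéodory's inequality for Taylor coefficients**: `g` holomorphic on
  `‖s‖ < R`, `g(0) = 0`, `Re g ≤ B` ⟹ `‖g⁽ⁿ⁾(0)‖ ≤ 2Bn!/Rⁿ` (`n ≥ 1`), from the coefficient inequality on every
  circle `ρ < R` (Cauchy's formula for the coefficients) and `ρ → R`;
* `iteratedDeriv_sum_pow_zero` — `(Σ_{j≤M} a_j s^j)⁽ⁿ⁾(0) = n!·a_n`;
* `exists_log_taylor_recursion` — for `F(s) = Σ_{j≤M} a_j s^j` (`a₀ = 1`) and an entire `P` (`P(0) = 0`) with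
  `F ≠ 0` and `log‖Fe^{−P}‖ ≤ B` on `‖s‖ < R`: the logarithm `g` of `Fe^{−P}` obeys `‖g⁽ᵏ⁾(0)‖ ≤ 2Bk!/R^k` and the
  Taylor coefficients `κ_k = (g + P)⁽ᵏ⁾(0)` satisfy the moment–cumulant (Newton) recursion
  `(k+1)!a_{k+1} = Σ_{i≤k} C(k,i) κ_{i+1} (k−i)!a_{k−i}` (Leibniz rule for `F′ = (g+P)′·F`).

Used by the Jensen programme (cell rh-jensen, route `JensenPolynomials`, support G1 `WindowCumulantOfZeroFree`: bounds on
the window cumulants of a coefficient sequence from a zero-free disc of its window EGF).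

References: E. C. Titchmarsh, *The Theory of Functions*, 2nd ed. (1939), §5.5 (Borel–Carathéodory and Carathéodory's
inequality), §2.5 (Cauchy's inequality / coefficient formulae). [Titchmarsh1939]
-/

noncomputable section

open Complex Metric Set Filter MeasureTheory intervalIntegral
open scoped Real Nat Topology NNReal

namespace Literature.Analysis.Complex

/-- **Holomorphic logarithm on a disc.** If `H` has derivative `H'` everywhere, `H'` is differentiable, `H ≠ 0` on the
open ball `‖s‖ < R` and `H(0) = 1`, then there is `g`, holomorphic on the ball, with `g(0) = 0`, `g′ = H′/H` and
`exp ∘ g = H` on the ball (the primitive of `H′/H`). [cite: Titchmarsh1939, §5.5] -/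
theorem exists_log_of_ne_zero_on_ball {H H' : ℂ → ℂ} {R : ℝ} (hR : 0 < R)
    (hH : ∀ s, HasDerivAt H (H' s) s) (hH' : Differentiable ℂ H')
    (hne : ∀ s ∈ ball (0 : ℂ) R, H s ≠ 0) (h0 : H 0 = 1) :
    ∃ g : ℂ → ℂ, g 0 = 0 ∧ (∀ s ∈ ball (0 : ℂ) R, HasDerivAt g (H' s / H s) s) ∧
      ∀ s ∈ ball (0 : ℂ) R, Complex.exp (g s) = H s := by
  have hq : DifferentiableOn ℂ (fun s => H' s / H s) (ball 0 R) :=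
    hH'.differentiableOn.div (fun s _ => (hH s).differentiableAt.differentiableWithinAt) hne
  obtain ⟨g₁, hg₁⟩ := hq.isExactOn_ball
  refine ⟨fun s => g₁ s - g₁ 0, by simp, fun s hs => (hg₁ s hs).sub_const _, ?_⟩
  have hφ : ∀ s ∈ ball (0 : ℂ) R, HasDerivAt (fun s => H s * Complex.exp (-(g₁ s - g₁ 0))) 0 s := by
    intro s hs
    have h1 := hH s
    have h2 : HasDerivAt (fun x => Complex.exp (-(g₁ x - g₁ 0)))
        (Complex.exp (-(g₁ s - g₁ 0)) * -(H' s / H s)) s := (((hg₁ s hs).sub_const (g₁ 0)).neg).cexp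
    have h3 : HasDerivAt (fun x => H x * Complex.exp (-(g₁ x - g₁ 0)))
        (H' s * Complex.exp (-(g₁ s - g₁ 0)) + H s * (Complex.exp (-(g₁ s - g₁ 0)) * -(H' s / H s))) s :=
      h1.mul h2
    have e : H' s * Complex.exp (-(g₁ s - g₁ 0)) +
        H s * (Complex.exp (-(g₁ s - g₁ 0)) * -(H' s / H s)) = 0 := by
      field_simp [hne s hs]
      ring
    exact h3.congr_deriv e
  have hconst : ∀ s ∈ ball (0 : ℂ) R, H s * Complex.exp (-(g₁ s - g₁ 0)) = 1 := by
    intro s hs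
    have h := IsOpen.is_const_of_deriv_eq_zero isOpen_ball (convex_ball (0 : ℂ) R).isPreconnected
      (fun s hs => (hφ s hs).differentiableAt.differentiableWithinAt) (fun s hs => (hφ s hs).deriv)
      hs (mem_ball_self hR)
    rw [h, h0, sub_self, neg_zero, Complex.exp_zero, one_mul]
  intro s hs
  have h := hconst s hs
  have hexp : Complex.exp (-(g₁ s - g₁ 0)) ≠ 0 := Complex.exp_ne_zero _
  calc Complex.exp (g₁ s - g₁ 0) = Complex.exp (g₁ s - g₁ 0) * (H s * Complex.exp (-(g₁ s - g₁ 0))) := by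
        rw [h, mul_one]
    _ = H s := by rw [Complex.exp_neg]; field_simp

/-- **Carathéodory bound on the Taylor coefficients of a holomorphic function with bounded real part**: if `g` is
holomorphic on `‖s‖ < R`, `g(0) = 0` and `Re g ≤ B` there, then `‖g⁽ⁿ⁾(0)‖ ≤ 2·B·n!/Rⁿ` for every `n ≥ 1`.
[cite: Titchmarsh1939, §5.5] -/
theorem norm_iteratedDeriv_le_of_re_le {g : ℂ → ℂ} {R B : ℝ} (hR : 0 < R)
    (hg : DifferentiableOn ℂ g (ball 0 R)) (hg0 : g 0 = 0) (hB : ∀ s ∈ ball (0 : ℂ) R, (g s).re ≤ B)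
    {n : ℕ} (hn : 1 ≤ n) : ‖iteratedDeriv n g 0‖ ≤ 2 * B * (n ! : ℝ) / R ^ n := by
  -- for every ρ ∈ (0, R): the bound with ρ
  have key : ∀ ρ : ℝ, 0 < ρ → ρ < R → ‖iteratedDeriv n g 0‖ ≤ 2 * B * (n ! : ℝ) / ρ ^ n := by
    intro ρ hρ0 hρR
    have hcl : closedBall (0 : ℂ) ρ ⊆ ball 0 R := closedBall_subset_ball hρR
    have hdc : DiffContOnCl ℂ g (ball 0 ρ) :=
      (hg.mono ((closure_ball (0 : ℂ) hρ0.ne').symm ▸ hcl)).diffContOnCl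
    -- Cauchy power series at radius ρ
    have hps := hdc.hasFPowerSeriesOnBall (R := ⟨ρ, hρ0.le⟩) (by exact_mod_cast hρ0)
    have hfs := hps.factorial_smul (y := (1 : ℂ)) n
    -- `n! • p n 1 = iteratedDeriv n g 0`
    rw [← iteratedDeriv_eq_iteratedFDeriv] at hfs
    have hcoef : (cauchyPowerSeries g 0 (⟨ρ, hρ0.le⟩ : ℝ≥0) n fun _ => (1 : ℂ)) =
        (2 * π * I : ℂ)⁻¹ • ∮ z in C(0, ρ), z⁻¹ ^ n • z⁻¹ • g z := by
      rw [cauchyPowerSeries_apply]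
      simp only [sub_zero, one_div]
    have hbc := norm_cauchyCoeff_le_of_re_le hρ0 hdc (B := B)
      (fun θ => hB _ (hcl (circleMap_mem_closedBall 0 hρ0.le θ))) hn
    rw [hg0, Complex.zero_re, sub_zero, ← hcoef] at hbc
    have hnorm : ‖iteratedDeriv n g 0‖ =
        (n ! : ℝ) * ‖cauchyPowerSeries g 0 (⟨ρ, hρ0.le⟩ : ℝ≥0) n fun _ => (1 : ℂ)‖ := by
      rw [← hfs, nsmul_eq_mul, norm_mul, Complex.norm_natCast]
      try rfl
    rw [hnorm]
    calc (n ! : ℝ) * ‖cauchyPowerSeries g 0 (⟨ρ, hρ0.le⟩ : ℝ≥0) n fun _ => (1 : ℂ)‖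
        ≤ (n ! : ℝ) * (2 * B / ρ ^ n) := by gcongr
      _ = 2 * B * (n ! : ℝ) / ρ ^ n := by ring
  -- let ρ → R⁻
  have htend : Tendsto (fun ρ : ℝ => 2 * B * (n ! : ℝ) / ρ ^ n) (𝓝[<] R) (𝓝 (2 * B * (n ! : ℝ) / R ^ n)) := by
    have hc : ContinuousAt (fun ρ : ℝ => 2 * B * (n ! : ℝ) / ρ ^ n) R :=
      continuousAt_const.div (continuousAt_id.pow n) (pow_ne_zero _ hR.ne')
    exact hc.tendsto.mono_left nhdsWithin_le_nhds
  refine ge_of_tendsto htend ?_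
  have hpos : ∀ᶠ ρ in 𝓝[<] R, 0 < ρ := by
    have hmem : Ioo (R / 2) R ∈ 𝓝[<] R := Ioo_mem_nhdsLT (by linarith)
    filter_upwards [hmem] with ρ hρ using by linarith [hρ.1]
  filter_upwards [hpos, self_mem_nhdsWithin] with ρ hρ0 hρR
  exact key ρ hρ0 hρR

/-- Iterated derivatives at `0` of a polynomial written as `∑_{j ≤ M} a_j s^j`. [cite: Titchmarsh1939, §2.5] -/
theorem iteratedDeriv_sum_pow_zero (a : ℕ → ℂ) (M n : ℕ) :
    iteratedDeriv n (fun s : ℂ => ∑ j ∈ Finset.range (M + 1), a j * s ^ j) 0 =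
      if n ≤ M then a n * (n ! : ℂ) else 0 := by
  rw [iteratedDeriv_fun_sum (fun j _ => (contDiffAt_id.pow j).const_smul (a j))]
  have e : ∀ j ∈ Finset.range (M + 1), iteratedDeriv n (fun s : ℂ => a j * s ^ j) 0 =
      if n = j then a j * (j ! : ℂ) else 0 := by
    intro j _
    have hpow : ContDiffAt ℂ n (fun x : ℂ => x ^ j) 0 := contDiffAt_id.pow j
    rw [iteratedDeriv_const_mul (a j) hpow, iteratedDeriv_fun_pow_zero]
    split_ifs <;> simp
  rw [Finset.sum_congr rfl e, Finset.sum_ite_eq]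
  simp only [Finset.mem_range]
  split_ifs with h1 h2 h2
  · rfl
  · omega
  · omega
  · rfl

/-- Derivative of the finite sum `∑ a_j s^j`. [folklore] -/
private theorem hasDerivAt_sum_pow (a : ℕ → ℂ) (M : ℕ) (s : ℂ) :
    HasDerivAt (fun s : ℂ => ∑ j ∈ Finset.range (M + 1), a j * s ^ j)
      (∑ j ∈ Finset.range (M + 1), a j * ((j : ℂ) * s ^ (j - 1))) s :=
  HasDerivAt.fun_sum fun j _ => (hasDerivAt_pow j s).const_mul (a j)

/-- **The analytic cumulant bound (core of G1).**  Let `F(s) = ∑_{j ≤ M} a_j s^j` with `a_0 = 1`, `P` a function with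
`P(0) = 0` given with its derivative `P′` (both entire), and suppose `F(s) ≠ 0` and `log ‖F(s)e^{−P(s)}‖ ≤ B` for
`‖s‖ < R`.  Let `g` be the holomorphic logarithm of `Fe^{−P}` on the ball (`g(0) = 0`).  Then
`‖g⁽ᵏ⁾(0)‖ ≤ 2Bk!/R^k` (`k ≥ 1`) and the numbers `κ_k = (g + P)⁽ᵏ⁾(0)` satisfy the moment–cumulant recursion
`(k+1)!a_{k+1} = ∑_{i ≤ k} C(k,i) κ_{i+1} (k−i)! a_{k−i}` for `k + 1 ≤ M`. [cite: Titchmarsh1939, §5.5] -/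
theorem exists_log_taylor_recursion (a : ℕ → ℂ) (M : ℕ) (ha0 : a 0 = 1) {P P' : ℂ → ℂ}
    (hP : ∀ s, HasDerivAt P (P' s) s) (hP' : Differentiable ℂ P') (hP0 : P 0 = 0) {R B : ℝ} (hR : 0 < R)
    (hne : ∀ s ∈ ball (0 : ℂ) R, (∑ j ∈ Finset.range (M + 1), a j * s ^ j) ≠ 0)
    (hB : ∀ s ∈ ball (0 : ℂ) R,
      Real.log ‖(∑ j ∈ Finset.range (M + 1), a j * s ^ j) * Complex.exp (-(P s))‖ ≤ B) :
    ∃ g : ℂ → ℂ, g 0 = 0 ∧ DifferentiableOn ℂ g (ball 0 R) ∧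
      (∀ n, 1 ≤ n → ‖iteratedDeriv n g 0‖ ≤ 2 * B * (n ! : ℝ) / R ^ n) ∧
      (∀ k, k + 1 ≤ M → a (k + 1) * ((k + 1)! : ℂ) =
        ∑ i ∈ Finset.range (k + 1), (k.choose i : ℂ) * iteratedDeriv (i + 1) (fun s => g s + P s) 0 *
          (a (k - i) * ((k - i)! : ℂ))) := by
  set F : ℂ → ℂ := fun s => ∑ j ∈ Finset.range (M + 1), a j * s ^ j with hF
  set F' : ℂ → ℂ := fun s => ∑ j ∈ Finset.range (M + 1), a j * ((j : ℂ) * s ^ (j - 1)) with hF'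
  have hFd : ∀ s, HasDerivAt F (F' s) s := fun s => hasDerivAt_sum_pow a M s
  have hF'd : Differentiable ℂ F' := by
    intro s
    have : HasDerivAt F' (∑ j ∈ Finset.range (M + 1), a j * ((j : ℂ) * ((((j - 1 : ℕ)) : ℂ) * s ^ (j - 1 - 1)))) s :=
      HasDerivAt.fun_sum fun j _ => ((hasDerivAt_pow (j - 1) s).const_mul (j : ℂ)).const_mul (a j)
    exact this.differentiableAt
  -- H = F e^{−P}
  set H : ℂ → ℂ := fun s => F s * Complex.exp (-(P s)) with hH
  set H' : ℂ → ℂ := fun s => F' s * Complex.exp (-(P s)) + F s * (Complex.exp (-(P s)) * -(P' s)) with hH'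
  have hHd : ∀ s, HasDerivAt H (H' s) s := fun s => (hFd s).mul ((hP s).neg.cexp)
  have hH'd : Differentiable ℂ H' := by
    have hE : Differentiable ℂ fun s => Complex.exp (-(P s)) := fun s => ((hP s).neg.cexp).differentiableAt
    have hFdiff : Differentiable ℂ F := fun s => (hFd s).differentiableAt
    have hPd : Differentiable ℂ P := fun s => (hP s).differentiableAt
    exact (hF'd.mul hE).add (hFdiff.mul (hE.mul hP'.neg))
  have hHne : ∀ s ∈ ball (0 : ℂ) R, H s ≠ 0 := fun s hs => mul_ne_zero (hne s hs) (Complex.exp_ne_zero _)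
  have hH0 : H 0 = 1 := by
    simp only [hH, hF, hP0, neg_zero, Complex.exp_zero, mul_one]
    rw [Finset.sum_eq_single 0 (fun j _ hj => by simp [zero_pow hj]) (by simp), pow_zero, mul_one, ha0]
  obtain ⟨g, hg0, hgd, hgexp⟩ := exists_log_of_ne_zero_on_ball hR hHd hH'd hHne hH0
  have hgdiff : DifferentiableOn ℂ g (ball 0 R) := fun s hs => (hgd s hs).differentiableAt.differentiableWithinAt
  have hgre : ∀ s ∈ ball (0 : ℂ) R, (g s).re ≤ B := by
    intro s hs
    have h1 : ‖H s‖ = Real.exp (g s).re := by rw [← hgexp s hs, Complex.norm_exp]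
    have h2 : (g s).re = Real.log ‖H s‖ := by rw [h1, Real.log_exp]
    rw [h2]; exact hB s hs
  refine ⟨g, hg0, hgdiff, fun n hn => norm_iteratedDeriv_le_of_re_le hR hgdiff hg0 hgre hn, ?_⟩
  -- the recursion
  set q : ℂ → ℂ := fun s => F' s / F s with hq
  have hgF : ∀ s ∈ ball (0 : ℂ) R, HasDerivAt (fun s => g s + P s) (q s) s := by
    intro s hs
    have h := (hgd s hs).add (hP s)
    have e : H' s / H s + P' s = q s := by
      simp only [hH', hH, hq]
      have hFs : F s ≠ 0 := hne s hs
      have hEs : Complex.exp (-(P s)) ≠ 0 := Complex.exp_ne_zero _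
      field_simp
      ring
    rw [e] at h
    exact h
  have hqd : DifferentiableOn ℂ q (ball 0 R) :=
    hF'd.differentiableOn.div (fun s _ => (hFd s).differentiableAt.differentiableWithinAt) hne
  have hFdiff : Differentiable ℂ F := fun s => (hFd s).differentiableAt
  have hFC : ∀ n : ℕ, ContDiffAt ℂ n F 0 := fun n => (hFdiff.contDiff (n := n)).contDiffAt
  -- F' = q F near 0, and deriv (g + P) = q near 0
  have hball : ball (0 : ℂ) R ∈ 𝓝 (0 : ℂ) := isOpen_ball.mem_nhds (mem_ball_self hR)
  have hFqF : F' =ᶠ[𝓝 0] fun s => q s * F s := by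
    filter_upwards [hball] with s hs
    simp only [hq]
    rw [div_mul_cancel₀ _ (hne s hs)]
  have hderivgF : deriv (fun s => g s + P s) =ᶠ[𝓝 0] q := by
    filter_upwards [hball] with s hs
    exact (hgF s hs).deriv
  have hderivF : deriv F = F' := funext fun s => (hFd s).deriv
  intro k hk
  -- (k+1)-st derivative of F at 0 two ways
  have lhs : iteratedDeriv (k + 1) F 0 = a (k + 1) * ((k + 1)! : ℂ) := by
    rw [hF, iteratedDeriv_sum_pow_zero, if_pos hk]
  have rhs : iteratedDeriv (k + 1) F 0 =
      ∑ i ∈ Finset.range (k + 1), (k.choose i : ℂ) * iteratedDeriv i q 0 * iteratedDeriv (k - i) F 0 := by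
    have hqC : ContDiffAt ℂ k q 0 := (hqd.contDiffOn isOpen_ball).contDiffAt hball
    rw [iteratedDeriv_succ', hderivF, hFqF.iteratedDeriv_eq, iteratedDeriv_fun_mul hqC (hFC k)]
  have hκ : ∀ i, iteratedDeriv i q 0 = iteratedDeriv (i + 1) (fun s => g s + P s) 0 := by
    intro i
    rw [iteratedDeriv_succ', hderivgF.iteratedDeriv_eq]
  have hm : ∀ i ∈ Finset.range (k + 1), iteratedDeriv (k - i) F 0 = a (k - i) * ((k - i)! : ℂ) := by
    intro i hi
    rw [hF, iteratedDeriv_sum_pow_zero, if_pos (by omega)]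
  rw [← lhs, rhs]
  refine Finset.sum_congr rfl fun i hi => ?_
  rw [hκ i, hm i hi]

end Literature.Analysis.Complex

end
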